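import Literature.Analysis.FluidPDE.GaussianVortexSchauderSet
import Literature.Analysis.Convex.SchauderFixedPoint
import HarnessLib

/-!
# Existence of asymmetric Burgers vortices of arbitrary circulation by Schauder's theorem

Analysis/FluidPDE definitions file: the Leray–Schauder (Schauder) step of the existence proof
behind the named fact `GallayMaekawa2016_thm41` (Gallay–Maekawa 2016, Thm. 4.1; M2 = Maekawa,
M3AS 19 (2009)). For `λ ∈ [0,1)` and `α ≥ 0` we construct, in the ground-state variables
`w = ρ_λ u`, `U = (u, G) ∈ H = H¹(μ_λ)`, a solution of the fixed-point problem
`u = (driftSolve_{v_u, κ} u).fst`, `v_u = K_{2D} ∗ (ρ_λ u)`, on the closed convex set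
`K = schauderSet ⊆ L²(μ_λ)` of first components of pairs `U ∈ H` with `u ≥ 0`, `∫ u dμ_λ = α` and
the bounds `‖ρu‖₂ ≤ R₀`, `‖∇(ρu)‖₂ ≤ R₁`, `‖u‖ ≤ R_w`, `‖U‖_H ≤ R_H` (constants below): the map is a
continuous self-map of `K` with relatively compact image (`GaussianVortexDriftResolvent`,
`GaussianVortexFlatNash`, `GaussianVortexFormDomainRellich`), so Schauder's theorem
(`Literature.Analysis.Convex.exists_fixedPoint_of_isCompact_closure`) applies. The output
`exists_weakSolution_nonneg` (`α ≥ 0`) is a pair `U ∈ H` with `u ≥ 0`, `∫ u dμ_λ = α`, and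
`⟪G, G_Φ⟫ = ⟪u v_u, G_Φ⟫` for all `Φ ∈ H` — the weak form of `L_λ w = (v·∇)w`, `v = K_{2D} ∗ w`.

## References

* Th. Gallay, Y. Maekawa, *Existence and stability of viscous vortices*, arXiv:1610.08384, §4.1,
  Thm. 4.1 ("the general existence result … established in [M2] relies on the Leray–Schauder fixed
  point theorem"). [GallayMaekawa2016]
* D. Gilbarg, N. S. Trudinger, *Elliptic Partial Differential Equations of Second Order*,
  Springer (2001), Cor. 11.2, Thm. 11.3. [GilbargTrudinger2001]
-/

open MeasureTheory Filter Set WithLp Metric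
open scoped Real RealInnerProductSpace Topology InnerProductSpace ContDiff

noncomputable section

namespace Literature.Analysis.FluidPDE

open Literature.Analysis.UnboundedOperators

variable {lam : ℝ} (hlam : lam ∈ Set.Ico (0 : ℝ) 1) (α : ℝ)

/-! ### The constants -/

section Constants

include hlam

/-- `Z = ⟪1, 1⟫ = μ_λ(ℝ²)`. [folklore] -/
def schauderZ : ℝ := ⟪gaussLamOne hlam, gaussLamOne hlam⟫

/-- The flat `L²` radius: `R₀² = C α²/2 + α²/Z + 4α²/((1−λ)Z) + 1`, `C = 4 C_GNS`. [folklore] -/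
def schauderR0sq : ℝ :=
  4 * (lintegralPowLePowLIntegralFDerivConst (volume : Measure (EuclideanSpace ℝ (Fin 2))) 2 : ℝ) * α ^ 2 / 2 +
    α ^ 2 / schauderZ hlam + 4 * α ^ 2 / ((1 - lam) * schauderZ hlam) + 1

omit hlam in
/-- `I₁ = ∫_{|z|<1} |z|⁻¹ dz`. [folklore] -/
def schauderI1 : ℝ := ∫ z, indicator (ball (0 : EuclideanSpace ℝ (Fin 2)) 1) (fun z => ‖z‖⁻¹) z

/-- The resolvent parameter `κ = (A₁ + √A₂)²`, `A₁ = (2π)⁻²(2R₀² + I₁)²/2`, `A₂ = 2(2π)⁻²α² + 1`,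
chosen so that `κ ≥ V₀² + 1` for the velocity bound `V₀` below. [folklore] -/
def schauderKappa : ℝ :=
  ((2 * Real.pi)⁻¹ ^ 2 * (2 * schauderR0sq hlam α + schauderI1) ^ 2 / 2 +
    Real.sqrt (2 * (2 * Real.pi)⁻¹ ^ 2 * α ^ 2 + 1)) ^ 2

/-- The velocity bound `V₀ = (2π)⁻¹((2R₀² + I₁) κ^{1/4}/2 + α)` on `K`. [folklore] -/
def schauderV0 : ℝ :=
  (2 * Real.pi)⁻¹ * ((2 * schauderR0sq hlam α + schauderI1) * Real.sqrt (Real.sqrt (schauderKappa hlam α)) / 2 + α)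

/-- The confinement parameter `s = 4(16/(1−λ)²)κ + 2(8/(1−λ))`. [folklore] -/
def schauderS : ℝ := 4 * (16 / (1 - lam) ^ 2) * schauderKappa hlam α + 2 * (8 / (1 - lam))

/-- The weighted radius `R_w² = 3 e^{s/2} R₀² + α²/Z`. [folklore] -/
def schauderRwsq : ℝ := 3 * Real.exp (schauderS hlam α / 2) * schauderR0sq hlam α + α ^ 2 / schauderZ hlam

/-- Basic signs of the constants: `0 < Z`, `0 < R₀²`, `0 ≤ I₁`, `1 ≤ κ`, `0 < R_w²` (for `α ≠ 0` not
needed). [folklore] -/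
theorem schauder_consts_pos :
    0 < schauderZ hlam ∧ 0 < schauderR0sq hlam α ∧ 0 ≤ schauderI1 ∧ 1 ≤ schauderKappa hlam α ∧
      0 < schauderRwsq hlam α := by
  have hq : 0 < 1 - lam := by linarith [hlam.2]
  have hZ : 0 < schauderZ hlam := inner_gaussLamOne_self_pos hlam
  have hC : (0 : ℝ) ≤ (lintegralPowLePowLIntegralFDerivConst (volume : Measure (EuclideanSpace ℝ (Fin 2))) 2 : ℝ) :=
    NNReal.coe_nonneg _
  have hR0 : 0 < schauderR0sq hlam α := by
    unfold schauderR0sq; positivity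
  have hI : 0 ≤ schauderI1 := integral_nonneg indicator_inv_norm_nonneg
  have hκ : 1 ≤ schauderKappa hlam α := by
    unfold schauderKappa
    have h1 : 1 ≤ Real.sqrt (2 * (2 * Real.pi)⁻¹ ^ 2 * α ^ 2 + 1) := by
      rw [Real.le_sqrt (by norm_num) (by positivity)]; nlinarith [sq_nonneg α, sq_nonneg (2 * Real.pi)⁻¹]
    have h2 : 0 ≤ (2 * Real.pi)⁻¹ ^ 2 * (2 * schauderR0sq hlam α + schauderI1) ^ 2 / 2 := by positivity
    nlinarith
  refine ⟨hZ, hR0, hI, hκ, ?_⟩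
  unfold schauderRwsq; positivity

/-- **The choice of `κ`**: `V₀² + 1 ≤ κ`. With `y = √κ`, `κ = (A₁ + √A₂)²` gives
`κ = A₁ y + √A₂ y ≥ A₁ y + A₂ ≥ V₀² + 1`, since `V₀² ≤ 2(2π)⁻²((2R₀²+I₁)² y/4 + α²)`. [folklore] -/
theorem schauderV0_sq_add_one_le : schauderV0 hlam α ^ 2 + 1 ≤ schauderKappa hlam α := by
  obtain ⟨-, hR0, hI, hκ1, -⟩ := schauder_consts_pos hlam α
  set A₁ : ℝ := (2 * Real.pi)⁻¹ ^ 2 * (2 * schauderR0sq hlam α + schauderI1) ^ 2 / 2 with hA₁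
  set A₂ : ℝ := 2 * (2 * Real.pi)⁻¹ ^ 2 * α ^ 2 + 1 with hA₂
  have hA₁0 : 0 ≤ A₁ := by positivity
  have hA₂1 : 1 ≤ A₂ := by rw [hA₂]; nlinarith [sq_nonneg α, sq_nonneg (2 * Real.pi)⁻¹]
  have hκdef : schauderKappa hlam α = (A₁ + Real.sqrt A₂) ^ 2 := rfl
  set y : ℝ := Real.sqrt (schauderKappa hlam α) with hy
  have hy_eq : y = A₁ + Real.sqrt A₂ := by
    rw [hy, hκdef, Real.sqrt_sq (by positivity)]
  have hκy : schauderKappa hlam α = y ^ 2 := by rw [hy, Real.sq_sqrt (by linarith)]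
  have hy0 : 0 ≤ y := Real.sqrt_nonneg _
  have hsA₂ : Real.sqrt A₂ ^ 2 = A₂ := Real.sq_sqrt (by linarith)
  -- `V₀² ≤ 2 c² ((2R₀²+I₁)² y /4 + α²)`, `c = (2π)⁻¹`, using `(√(√κ))² = y`
  have hV : schauderV0 hlam α ^ 2 ≤ A₁ * y + (A₂ - 1) := by
    unfold schauderV0
    rw [← hy]
    have hss : Real.sqrt y ^ 2 = y := Real.sq_sqrt hy0
    have hc0 : 0 ≤ (2 * Real.pi)⁻¹ := by positivity
    have key : ∀ a b : ℝ, (a + b) ^ 2 ≤ 2 * a ^ 2 + 2 * b ^ 2 := fun a b => by nlinarith [sq_nonneg (a - b)]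
    calc ((2 * Real.pi)⁻¹ * ((2 * schauderR0sq hlam α + schauderI1) * Real.sqrt y / 2 + α)) ^ 2
        = (2 * Real.pi)⁻¹ ^ 2 * ((2 * schauderR0sq hlam α + schauderI1) * Real.sqrt y / 2 + α) ^ 2 := by ring
      _ ≤ (2 * Real.pi)⁻¹ ^ 2 * (2 * ((2 * schauderR0sq hlam α + schauderI1) * Real.sqrt y / 2) ^ 2 + 2 * α ^ 2) :=
          mul_le_mul_of_nonneg_left (key _ _) (by positivity)
      _ = A₁ * y + (A₂ - 1) := by rw [hA₁, hA₂]; field_simp; rw [hss]; ring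
  calc schauderV0 hlam α ^ 2 + 1 ≤ A₁ * y + A₂ := by linarith
    _ ≤ A₁ * y + Real.sqrt A₂ * y := by
        have : A₂ ≤ Real.sqrt A₂ * y := by
          rw [hy_eq]
          have hs0 : 0 ≤ Real.sqrt A₂ := Real.sqrt_nonneg _
          nlinarith [hsA₂]
        linarith
    _ = schauderKappa hlam α := by rw [hκy, hy_eq]; ring

/-- `V₀²/2 + ½ ≤ κ` (the hypothesis of `driftSolve`). [folklore] -/
theorem schauderKappa_ge : schauderV0 hlam α ^ 2 / 2 + 1 / 2 ≤ schauderKappa hlam α := by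
  have := schauderV0_sq_add_one_le hlam α; nlinarith [sq_nonneg (schauderV0 hlam α)]

end Constants

/-! ### The convex set `K` -/

section TheSet

include hlam

/-- The constraint set on pairs: `U ∈ H`, `u ≥ 0`, `⟪1, u⟫ = α`, `‖S u‖ ≤ R₀`, `‖T U‖ ≤ R₁ = √κ R₀`,
`‖u‖ ≤ R_w`, `‖U‖ ≤ R_H = √(1+κ) R_w`. [folklore] -/
def schauderPairSet : Set (WithLp 2 (Lp ℝ 2 (gaussLamMeasure lam) × Lp (EuclideanSpace ℝ (Fin 2)) 2 (gaussLamMeasure lam))) :=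
  {U | U ∈ gaussLamFormDomain lam ∧ 0 ≤ᵐ[gaussLamMeasure lam] (U.fst : EuclideanSpace ℝ (Fin 2) → ℝ) ∧
    ⟪gaussLamOne hlam, U.fst⟫ = α ∧
    ‖sqrtWeightMulL hlam U.fst‖ ≤ Real.sqrt (schauderR0sq hlam α) ∧
    ‖flatGradL hlam U‖ ≤ Real.sqrt (schauderKappa hlam α) * Real.sqrt (schauderR0sq hlam α) ∧
    ‖U.fst‖ ≤ Real.sqrt (schauderRwsq hlam α) ∧
    ‖U‖ ≤ Real.sqrt (1 + schauderKappa hlam α) * Real.sqrt (schauderRwsq hlam α)}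

/-- **The Schauder set** `K ⊆ L²(μ_λ)`: first components of `schauderPairSet`. [folklore] -/
def schauderSet : Set (Lp ℝ 2 (gaussLamMeasure lam)) :=
  WithLp.fst '' schauderPairSet hlam α

/-- `K` is convex (linear image of an intersection of convex sets). [folklore] -/
theorem convex_schauderSet : Convex ℝ (schauderSet hlam α) := by
  unfold schauderSet
  refine Convex.is_linear_image ?_ (WithLp.fstₗ 2 ℝ (Lp ℝ 2 (gaussLamMeasure lam))
    (Lp (EuclideanSpace ℝ (Fin 2)) 2 (gaussLamMeasure lam))).isLinear
  intro U hU U' hU' a b ha hb hab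
  obtain ⟨h1, h2, h3, h4, h5, h6, h7⟩ := hU
  obtain ⟨h1', h2', h3', h4', h5', h6', h7'⟩ := hU'
  refine ⟨(gaussLamFormDomain lam).add_mem ((gaussLamFormDomain lam).smul_mem a h1)
    ((gaussLamFormDomain lam).smul_mem b h1'), ?_, ?_, ?_, ?_, ?_, ?_⟩
  · rw [WithLp.add_fst, WithLp.smul_fst, WithLp.smul_fst]
    filter_upwards [h2, h2', Lp.coeFn_add (a • U.fst) (b • U'.fst), Lp.coeFn_smul a U.fst, Lp.coeFn_smul b U'.fst]
      with x hx hx' hadd hsa hsb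
    rw [hadd, Pi.add_apply, hsa, hsb, Pi.smul_apply, Pi.smul_apply, smul_eq_mul, smul_eq_mul]
    exact add_nonneg (mul_nonneg ha hx) (mul_nonneg hb hx')
  · rw [WithLp.add_fst, WithLp.smul_fst, WithLp.smul_fst, inner_add_right, real_inner_smul_right,
      real_inner_smul_right, h3, h3']
    rw [← add_mul, hab, one_mul]
  · rw [WithLp.add_fst, WithLp.smul_fst, WithLp.smul_fst, map_add, map_smul, map_smul]
    calc _ ≤ ‖a • sqrtWeightMulL hlam U.fst‖ + ‖b • sqrtWeightMulL hlam U'.fst‖ := norm_add_le _ _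
      _ ≤ a * Real.sqrt (schauderR0sq hlam α) + b * Real.sqrt (schauderR0sq hlam α) := by
          rw [norm_smul, norm_smul, Real.norm_of_nonneg ha, Real.norm_of_nonneg hb]
          exact add_le_add (mul_le_mul_of_nonneg_left h4 ha) (mul_le_mul_of_nonneg_left h4' hb)
      _ = Real.sqrt (schauderR0sq hlam α) := by rw [← add_mul, hab, one_mul]
  · rw [map_add, map_smul, map_smul]
    calc _ ≤ ‖a • flatGradL hlam U‖ + ‖b • flatGradL hlam U'‖ := norm_add_le _ _
      _ ≤ a * (Real.sqrt (schauderKappa hlam α) * Real.sqrt (schauderR0sq hlam α)) +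
          b * (Real.sqrt (schauderKappa hlam α) * Real.sqrt (schauderR0sq hlam α)) := by
          rw [norm_smul, norm_smul, Real.norm_of_nonneg ha, Real.norm_of_nonneg hb]
          exact add_le_add (mul_le_mul_of_nonneg_left h5 ha) (mul_le_mul_of_nonneg_left h5' hb)
      _ = _ := by rw [← add_mul, hab, one_mul]
  · rw [WithLp.add_fst, WithLp.smul_fst, WithLp.smul_fst]
    calc _ ≤ ‖a • U.fst‖ + ‖b • U'.fst‖ := norm_add_le _ _
      _ ≤ a * Real.sqrt (schauderRwsq hlam α) + b * Real.sqrt (schauderRwsq hlam α) := by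
          rw [norm_smul, norm_smul, Real.norm_of_nonneg ha, Real.norm_of_nonneg hb]
          exact add_le_add (mul_le_mul_of_nonneg_left h6 ha) (mul_le_mul_of_nonneg_left h6' hb)
      _ = _ := by rw [← add_mul, hab, one_mul]
  · calc _ ≤ ‖a • U‖ + ‖b • U'‖ := norm_add_le _ _
      _ ≤ a * (Real.sqrt (1 + schauderKappa hlam α) * Real.sqrt (schauderRwsq hlam α)) +
          b * (Real.sqrt (1 + schauderKappa hlam α) * Real.sqrt (schauderRwsq hlam α)) := by
          rw [norm_smul, norm_smul, Real.norm_of_nonneg ha, Real.norm_of_nonneg hb]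
          exact add_le_add (mul_le_mul_of_nonneg_left h7 ha) (mul_le_mul_of_nonneg_left h7' hb)
      _ = _ := by rw [← add_mul, hab, one_mul]

/-- `K` is closed (`isClosed_fst_image_constraints` with the norm-closed constraints on `u`).
[folklore] -/
theorem isClosed_schauderSet : IsClosed (schauderSet hlam α) := by
  set P : Set (Lp ℝ 2 (gaussLamMeasure lam)) :=
    (({u | 0 ≤ᵐ[gaussLamMeasure lam] (u : EuclideanSpace ℝ (Fin 2) → ℝ)} ∩
      {u | ⟪gaussLamOne hlam, u⟫ = α}) ∩
      {u | ‖sqrtWeightMulL hlam u‖ ≤ Real.sqrt (schauderR0sq hlam α)}) ∩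
      {u | ‖u‖ ≤ Real.sqrt (schauderRwsq hlam α)} with hP
  have hPc : IsClosed P := by
    refine ((isClosed_nonneg_Lp (lam := lam)).inter ?_).inter ?_ |>.inter ?_
    · exact isClosed_eq (continuous_const.inner continuous_id) continuous_const
    · exact isClosed_le ((sqrtWeightMulL hlam).continuous.norm) continuous_const
    · exact isClosed_le continuous_norm continuous_const
  have h := isClosed_fst_image_constraints hlam hPc (Real.sqrt (schauderKappa hlam α) * Real.sqrt (schauderR0sq hlam α))
    (Real.sqrt (1 + schauderKappa hlam α) * Real.sqrt (schauderRwsq hlam α))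
  convert h using 1
  ext u
  simp only [schauderSet, schauderPairSet, mem_image, mem_setOf_eq, hP, mem_inter_iff]
  constructor
  · rintro ⟨U, ⟨h1, h2, h3, h4, h5, h6, h7⟩, hUu⟩
    subst hUu
    exact ⟨U, h1, rfl, ⟨⟨⟨h2, h3⟩, h4⟩, h6⟩, h5, h7⟩
  · rintro ⟨U, h1, hUu, ⟨⟨⟨h2, h3⟩, h4⟩, h6⟩, h5, h7⟩
    subst hUu
    exact ⟨U, ⟨h1, h2, h3, h4, h5, h6, h7⟩, rfl⟩

end TheSet

/-! ### Velocity fields of elements of `H` and of `K` -/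

section Velocity

include hlam

omit hlam in
/-- The velocity `K_{2D} ∗ (ρ_λ u)` is measurable. [folklore] -/
theorem measurable_velocity (u : Lp ℝ 2 (gaussLamMeasure lam)) :
    Measurable (biotSavart2D fun y : EuclideanSpace ℝ (Fin 2) =>
      Real.exp (-((1 + lam) / 4 * y 0 ^ 2 + (1 - lam) / 4 * y 1 ^ 2)) * (u : EuclideanSpace ℝ (Fin 2) → ℝ) y) :=
  (stronglyMeasurable_biotSavart2D (measurable_weight_mul_Lp u)).measurable

/-- The velocity of `w = ρ_λ u`, `U ∈ H¹(μ_λ)`, is weakly divergence-free. [folklore] -/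
theorem velocity_div_free
    {U : WithLp 2 (Lp ℝ 2 (gaussLamMeasure lam) × Lp (EuclideanSpace ℝ (Fin 2)) 2 (gaussLamMeasure lam))}
    (hU : U ∈ gaussLamFormDomain lam) (h : EuclideanSpace ℝ (Fin 2) → ℝ) (hh : ContDiff ℝ 1 h)
    (hhc : HasCompactSupport h) :
    ∫ x, ⟪biotSavart2D (fun y : EuclideanSpace ℝ (Fin 2) =>
        Real.exp (-((1 + lam) / 4 * y 0 ^ 2 + (1 - lam) / 4 * y 1 ^ 2)) * (U.fst : EuclideanSpace ℝ (Fin 2) → ℝ) y) x,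
        gradient h x⟫ = 0 := by
  obtain ⟨hwi, -⟩ := integrable_weight_mul_Lp hlam U.fst
  exact integral_inner_biotSavart2D_gradient_eq_zero hwi (integrable_weight_mul_smul_biotSavartKernel2D hlam hU)
    (integral_norm_weight_mul_smul_biotSavartKernel2D_le hlam hU) hh hhc

/-- `∫ |ρ u| dx = ⟪1, u⟫_{L²(μ)}` for `u ≥ 0`. [folklore] -/
theorem integral_abs_weight_mul_eq_inner_one {u : Lp ℝ 2 (gaussLamMeasure lam)}
    (hu : 0 ≤ᵐ[gaussLamMeasure lam] (u : EuclideanSpace ℝ (Fin 2) → ℝ)) :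
    ∫ x : EuclideanSpace ℝ (Fin 2), |Real.exp (-((1 + lam) / 4 * x 0 ^ 2 + (1 - lam) / 4 * x 1 ^ 2)) *
      (u : EuclideanSpace ℝ (Fin 2) → ℝ) x| = ⟪gaussLamOne hlam, u⟫ := by
  rw [inner_gaussLamOne_left hlam, integral_gaussLamMeasure]
  refine integral_congr_ae ?_
  filter_upwards [(ae_gaussLamMeasure_iff lam).1 hu] with x hx
  rw [abs_of_nonneg (mul_nonneg (Real.exp_pos _).le hx), mul_comm]

variable {α} in
/-- **The velocity bound on `K`**: for `U ∈ schauderPairSet`, `‖(K_{2D} ∗ ρu)(x)‖ ≤ V₀` for all `x`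
(flat velocity bound with `t = κ^{-1/4}`, `‖S u‖ ≤ R₀`, `‖T U‖ ≤ √κ R₀`, `‖ρu‖₁ = α`). [folklore] -/
theorem norm_velocity_le_of_mem
    {U : WithLp 2 (Lp ℝ 2 (gaussLamMeasure lam) × Lp (EuclideanSpace ℝ (Fin 2)) 2 (gaussLamMeasure lam))}
    (hU : U ∈ schauderPairSet hlam α) (x : EuclideanSpace ℝ (Fin 2)) :
    ‖biotSavart2D (fun y : EuclideanSpace ℝ (Fin 2) =>
        Real.exp (-((1 + lam) / 4 * y 0 ^ 2 + (1 - lam) / 4 * y 1 ^ 2)) * (U.fst : EuclideanSpace ℝ (Fin 2) → ℝ) y) x‖ ≤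
      schauderV0 hlam α := by
  obtain ⟨hH, hnn, hmass, hS, hT, -, -⟩ := hU
  obtain ⟨hZ, hR0, hI, hκ1, -⟩ := schauder_consts_pos hlam α
  set κ := schauderKappa hlam α with hκ
  set R0 := Real.sqrt (schauderR0sq hlam α) with hR0def
  have hR0sq : R0 ^ 2 = schauderR0sq hlam α := Real.sq_sqrt hR0.le
  have hR00 : 0 ≤ R0 := Real.sqrt_nonneg _
  set y := Real.sqrt κ with hy
  have hy1 : 1 ≤ y := by rw [hy, Real.le_sqrt (by norm_num) (by linarith)]; simpa using hκ1
  set r := Real.sqrt y with hr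
  have hr1 : 1 ≤ r := by rw [hr, Real.le_sqrt (by norm_num) (by linarith)]; simpa using hy1
  have hr0 : 0 < r := by linarith
  have hrsq : r ^ 2 = y := Real.sq_sqrt (by linarith)
  -- the flat bound with `t = r⁻¹`
  have hflat := norm_biotSavart2D_weight_mul_le_flat hlam hH x (t := r⁻¹) (by positivity)
  -- rewrite the flat quantities
  have hX : Real.sqrt ⟪U.fst, (memLp_weight_mul_fst hlam U.fst).toLp _⟫ = ‖sqrtWeightMulL hlam U.fst‖ := by
    rw [← norm_sqrtWeightMulL_sq hlam, Real.sqrt_sq (norm_nonneg _)]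
  have hD : Real.sqrt (∫ x, Real.exp (-((1 + lam) / 4 * x 0 ^ 2 + (1 - lam) / 4 * x 1 ^ 2)) *
      ‖(U.snd : EuclideanSpace ℝ (Fin 2) → EuclideanSpace ℝ (Fin 2)) x -
        (U.fst : EuclideanSpace ℝ (Fin 2) → ℝ) x •
          (toLp 2 ![(1 + lam) / 2 * x 0, (1 - lam) / 2 * x 1] : EuclideanSpace ℝ (Fin 2))‖ ^ 2 ∂gaussLamMeasure lam) =
      ‖flatGradL hlam U‖ := by
    rw [← norm_flatGradL_sq hlam, Real.sqrt_sq (norm_nonneg _)]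
  have hM : ∫ x : EuclideanSpace ℝ (Fin 2), |Real.exp (-((1 + lam) / 4 * x 0 ^ 2 + (1 - lam) / 4 * x 1 ^ 2)) *
      (U.fst : EuclideanSpace ℝ (Fin 2) → ℝ) x| = α := by
    rw [integral_abs_weight_mul_eq_inner_one hlam hnn, hmass]
  rw [hX, hD, hM] at hflat
  refine hflat.trans ?_
  unfold schauderV0
  rw [← hκ, ← hy, ← hr]
  have hπ : 0 < (2 * Real.pi)⁻¹ := by positivity
  refine mul_le_mul_of_nonneg_left (add_le_add_left ?_ α) hπ.le
  refine div_le_div_of_nonneg_right ?_ two_pos.le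
  -- `r⁻¹ (2 ‖Su‖ ‖TU‖) + r I₁ ≤ (2R₀² + I₁) r`
  have h1 : ‖sqrtWeightMulL hlam U.fst‖ * ‖flatGradL hlam U‖ ≤ R0 * (y * R0) :=
    mul_le_mul hS hT (norm_nonneg _) hR00
  have h2 : r⁻¹ * (2 * ‖sqrtWeightMulL hlam U.fst‖ * ‖flatGradL hlam U‖) ≤ 2 * schauderR0sq hlam α * r := by
    rw [← hR0sq, inv_mul_le_iff₀ hr0]
    calc 2 * ‖sqrtWeightMulL hlam U.fst‖ * ‖flatGradL hlam U‖ ≤ 2 * (R0 * (y * R0)) := by nlinarith [h1]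
      _ = r * (2 * R0 ^ 2 * r) := by rw [← hrsq]; ring
  rw [inv_inv]
  change r⁻¹ * (2 * ‖sqrtWeightMulL hlam U.fst‖ * ‖flatGradL hlam U‖) + r * schauderI1 ≤ _
  nlinarith [h2]

end Velocity

/-! ### `K` is nonempty: the Gaussian `α 𝒢_λ`, i.e. `u₀ = (α/Z) · 1` -/

section Nonempty

include hlam

/-- `‖T U‖ ≤ (2/√(1−λ)) ‖u‖` when the gradient component vanishes. [folklore] -/
theorem norm_flatGradL_le_of_snd_eq_zero (u : Lp ℝ 2 (gaussLamMeasure lam)) :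
    ‖flatGradL hlam (toLp 2 (u, 0))‖ ≤ 2 / Real.sqrt (1 - lam) * ‖u‖ := by
  refine Lp.norm_le_mul_norm_of_ae_le_mul ?_
  filter_upwards [flatGradL_ae hlam (toLp 2 (u, 0)), Lp.coeFn_zero (EuclideanSpace ℝ (Fin 2)) 2 (gaussLamMeasure lam)]
    with x hx h0
  rw [hx, WithLp.toLp_snd, WithLp.toLp_fst, h0, Pi.zero_apply, smul_zero, zero_sub, norm_neg, norm_smul, norm_smul,
    Real.norm_of_nonneg (Real.sqrt_nonneg _), mul_comm]
  exact mul_le_mul_of_nonneg_right (sqrt_expNegQuadLam_mul_norm_driftLam_le hlam x) (norm_nonneg _)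

variable {α} in
/-- **`K` is nonempty**: `u₀ = (α/Z)·1 ∈ K` for `α ≥ 0`. [folklore] -/
theorem schauderSet_nonempty (hα : 0 ≤ α) : (schauderSet hlam α).Nonempty := by
  obtain ⟨hZ, hR0, hI, hκ1, hRw⟩ := schauder_consts_pos hlam α
  have hq : 0 < 1 - lam := by linarith [hlam.2]
  set c : ℝ := α / schauderZ hlam with hc
  have hc0 : 0 ≤ c := div_nonneg hα hZ.le
  set u₀ : Lp ℝ 2 (gaussLamMeasure lam) := c • gaussLamOne hlam with hu₀
  set U₀ : WithLp 2 (Lp ℝ 2 (gaussLamMeasure lam) × Lp (EuclideanSpace ℝ (Fin 2)) 2 (gaussLamMeasure lam)) :=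
    toLp 2 (u₀, 0) with hU₀
  have hU₀eq : U₀ = c • toLp 2 (gaussLamOne hlam, 0) := by
    rw [hU₀, hu₀, ← WithLp.toLp_smul, Prod.smul_mk, smul_zero]
  have hnorm1 : ‖gaussLamOne hlam‖ ^ 2 = schauderZ hlam := by rw [← real_inner_self_eq_norm_sq]; rfl
  have hu₀norm : ‖u₀‖ ^ 2 = α ^ 2 / schauderZ hlam := by
    rw [hu₀, norm_smul, mul_pow, Real.norm_of_nonneg hc0, hnorm1, hc]
    field_simp
  have hU₀norm : ‖U₀‖ = ‖u₀‖ := WithLp.norm_toLp_fst 2 _ _ u₀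
  refine ⟨u₀, U₀, ⟨?_, ?_, ?_, ?_, ?_, ?_, ?_⟩, rfl⟩
  · rw [hU₀eq]; exact (gaussLamFormDomain lam).smul_mem c (one_mem_gaussLamFormDomain hlam)
  · show 0 ≤ᵐ[gaussLamMeasure lam] (u₀ : EuclideanSpace ℝ (Fin 2) → ℝ)
    filter_upwards [Lp.coeFn_smul c (gaussLamOne hlam), gaussLamOne_ae_eq hlam] with x hx h1
    rw [hx, Pi.smul_apply, h1, smul_eq_mul, mul_one]
    exact hc0
  · show ⟪gaussLamOne hlam, u₀⟫ = α
    rw [hu₀, real_inner_smul_right, hc]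
    show α / schauderZ hlam * schauderZ hlam = α
    field_simp
  · show ‖sqrtWeightMulL hlam u₀‖ ≤ Real.sqrt (schauderR0sq hlam α)
    have h1 : ‖sqrtWeightMulL hlam u₀‖ ^ 2 ≤ schauderR0sq hlam α := by
      rw [norm_sqrtWeightMulL_sq hlam]
      calc _ ≤ ‖u₀‖ ^ 2 := inner_fst_weightMul_fst_le hlam u₀
        _ = α ^ 2 / schauderZ hlam := hu₀norm
        _ ≤ schauderR0sq hlam α := by
            unfold schauderR0sq
            have : (0 : ℝ) ≤ (lintegralPowLePowLIntegralFDerivConst (volume : Measure (EuclideanSpace ℝ (Fin 2))) 2 : ℝ) :=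
              NNReal.coe_nonneg _
            have h4 : 0 ≤ 4 * α ^ 2 / ((1 - lam) * schauderZ hlam) := by positivity
            nlinarith [sq_nonneg α]
    exact (Real.le_sqrt (norm_nonneg _) hR0.le).2 h1
  · show ‖flatGradL hlam U₀‖ ≤ Real.sqrt (schauderKappa hlam α) * Real.sqrt (schauderR0sq hlam α)
    have h1 : ‖flatGradL hlam U₀‖ ^ 2 ≤ schauderR0sq hlam α := by
      have h2 := norm_flatGradL_le_of_snd_eq_zero hlam u₀
      rw [← hU₀] at h2
      have h3 : ‖flatGradL hlam U₀‖ ^ 2 ≤ (2 / Real.sqrt (1 - lam) * ‖u₀‖) ^ 2 :=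
        pow_le_pow_left₀ (norm_nonneg _) h2 2
      rw [mul_pow, div_pow, Real.sq_sqrt hq.le, hu₀norm] at h3
      refine h3.trans ?_
      unfold schauderR0sq
      have : (0 : ℝ) ≤ (lintegralPowLePowLIntegralFDerivConst (volume : Measure (EuclideanSpace ℝ (Fin 2))) 2 : ℝ) :=
        NNReal.coe_nonneg _
      have e : (2 : ℝ) ^ 2 / (1 - lam) * (α ^ 2 / schauderZ hlam) = 4 * α ^ 2 / ((1 - lam) * schauderZ hlam) := by
        field_simp; ring
      rw [e]
      have : 0 ≤ α ^ 2 / schauderZ hlam := by positivity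
      nlinarith [sq_nonneg α]
    have h2 : Real.sqrt (schauderR0sq hlam α) ≤ Real.sqrt (schauderKappa hlam α) * Real.sqrt (schauderR0sq hlam α) := by
      have : 1 ≤ Real.sqrt (schauderKappa hlam α) := by
        rw [Real.le_sqrt (by norm_num) (by linarith)]; simpa using hκ1
      nlinarith [Real.sqrt_nonneg (schauderR0sq hlam α)]
    exact ((Real.le_sqrt (norm_nonneg _) hR0.le).2 h1).trans h2
  · show ‖u₀‖ ≤ Real.sqrt (schauderRwsq hlam α)
    refine (Real.le_sqrt (norm_nonneg _) hRw.le).2 ?_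
    rw [hu₀norm]
    unfold schauderRwsq
    have : 0 ≤ 3 * Real.exp (schauderS hlam α / 2) * schauderR0sq hlam α := by positivity
    linarith
  · show ‖U₀‖ ≤ Real.sqrt (1 + schauderKappa hlam α) * Real.sqrt (schauderRwsq hlam α)
    rw [hU₀norm]
    have h1 : ‖u₀‖ ≤ Real.sqrt (schauderRwsq hlam α) := by
      refine (Real.le_sqrt (norm_nonneg _) hRw.le).2 ?_
      rw [hu₀norm]
      unfold schauderRwsq
      have : 0 ≤ 3 * Real.exp (schauderS hlam α / 2) * schauderR0sq hlam α := by positivity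
      linarith
    have h2 : 1 ≤ Real.sqrt (1 + schauderKappa hlam α) := by
      rw [Real.le_sqrt (by norm_num) (by linarith)]; linarith
    nlinarith [Real.sqrt_nonneg (schauderRwsq hlam α), norm_nonneg u₀]

end Nonempty

/-! ### The Schauder map `Φ` and the self-map property `Φ(K) ⊆ K` -/

section TheMap

include hlam

variable {α} in
/-- Data of `u ∈ K`: `u ≥ 0`, `⟪1, u⟫ = α`, `‖S u‖ ≤ R₀`, `‖u‖ ≤ R_w`, the velocity bound
`‖v_u‖ ≤ V₀` and the weak divergence-freeness of `v_u = K_{2D} ∗ (ρu)`. [folklore] -/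
theorem mem_schauderSet_data {u : Lp ℝ 2 (gaussLamMeasure lam)} (hu : u ∈ schauderSet hlam α) :
    0 ≤ᵐ[gaussLamMeasure lam] (u : EuclideanSpace ℝ (Fin 2) → ℝ) ∧ ⟪gaussLamOne hlam, u⟫ = α ∧
    ‖sqrtWeightMulL hlam u‖ ≤ Real.sqrt (schauderR0sq hlam α) ∧ ‖u‖ ≤ Real.sqrt (schauderRwsq hlam α) ∧
    (∀ x, ‖biotSavart2D (fun y : EuclideanSpace ℝ (Fin 2) =>
        Real.exp (-((1 + lam) / 4 * y 0 ^ 2 + (1 - lam) / 4 * y 1 ^ 2)) * (u : EuclideanSpace ℝ (Fin 2) → ℝ) y) x‖ ≤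
      schauderV0 hlam α) ∧
    ∀ h : EuclideanSpace ℝ (Fin 2) → ℝ, ContDiff ℝ 1 h → HasCompactSupport h →
      ∫ x, ⟪biotSavart2D (fun y : EuclideanSpace ℝ (Fin 2) =>
        Real.exp (-((1 + lam) / 4 * y 0 ^ 2 + (1 - lam) / 4 * y 1 ^ 2)) * (u : EuclideanSpace ℝ (Fin 2) → ℝ) y) x,
        gradient h x⟫ = 0 := by
  obtain ⟨U, hU, rfl⟩ := hu
  exact ⟨hU.2.1, hU.2.2.1, hU.2.2.2.1, hU.2.2.2.2.2.1, norm_velocity_le_of_mem hlam hU, velocity_div_free hlam hU.1⟩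

variable {α} in
/-- The resolvent solution `U' = (κ − L_λ + v_u·∇)⁻¹ (κ ρu)` (in the variables `(u', G')`) attached to
`u ∈ K`. [folklore] -/
def schauderSolve {u : Lp ℝ 2 (gaussLamMeasure lam)} (hu : u ∈ schauderSet hlam α) : gaussLamFormDomain lam :=
  driftSolve lam (measurable_velocity u) (mem_schauderSet_data hlam hu).2.2.2.2.1 (schauderKappa_ge hlam α) u

open Classical in
/-- **The Schauder map** `Φ : L²(μ_λ) → L²(μ_λ)`: `Φ u = u'` (first component of `schauderSolve`)
for `u ∈ K`, and `Φ u = u` off `K`. [folklore] -/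
def schauderMap (u : Lp ℝ 2 (gaussLamMeasure lam)) : Lp ℝ 2 (gaussLamMeasure lam) :=
  if hu : u ∈ schauderSet hlam α then
    ((schauderSolve hlam hu : gaussLamFormDomain lam) : WithLp 2 (Lp ℝ 2 (gaussLamMeasure lam) ×
      Lp (EuclideanSpace ℝ (Fin 2)) 2 (gaussLamMeasure lam))).fst
  else u

variable {α} in
/-- `Φ u = u'` on `K`. [folklore] -/
theorem schauderMap_of_mem {u : Lp ℝ 2 (gaussLamMeasure lam)} (hu : u ∈ schauderSet hlam α) :
    schauderMap hlam α u = ((schauderSolve hlam hu : gaussLamFormDomain lam) : WithLp 2 (Lp ℝ 2 (gaussLamMeasure lam) ×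
      Lp (EuclideanSpace ℝ (Fin 2)) 2 (gaussLamMeasure lam))).fst := by
  rw [schauderMap, dif_pos hu]

variable {α} in
/-- **Flat a priori bounds for the image**: `u' ≥ 0`, `⟪1, u'⟫ = α`, `‖ρu'‖₂² ≤ R₀²` and
`‖∇(ρu')‖₂² ≤ κ R₀²` (maximum principle, mass conservation, flat energy inequality, Nash). [folklore] -/
theorem schauderSolve_flat {u : Lp ℝ 2 (gaussLamMeasure lam)} (hu : u ∈ schauderSet hlam α) :
    0 ≤ᵐ[gaussLamMeasure lam] (((schauderSolve hlam hu : gaussLamFormDomain lam) : WithLp 2 (Lp ℝ 2 (gaussLamMeasure lam) ×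
      Lp (EuclideanSpace ℝ (Fin 2)) 2 (gaussLamMeasure lam))).fst : EuclideanSpace ℝ (Fin 2) → ℝ) ∧
    ⟪gaussLamOne hlam, ((schauderSolve hlam hu : gaussLamFormDomain lam) : WithLp 2 (Lp ℝ 2 (gaussLamMeasure lam) ×
      Lp (EuclideanSpace ℝ (Fin 2)) 2 (gaussLamMeasure lam))).fst⟫ = α ∧
    ⟪((schauderSolve hlam hu : gaussLamFormDomain lam) : WithLp 2 (Lp ℝ 2 (gaussLamMeasure lam) ×
        Lp (EuclideanSpace ℝ (Fin 2)) 2 (gaussLamMeasure lam))).fst,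
      (memLp_weight_mul_fst hlam ((schauderSolve hlam hu : gaussLamFormDomain lam) : WithLp 2 (Lp ℝ 2 (gaussLamMeasure lam) ×
        Lp (EuclideanSpace ℝ (Fin 2)) 2 (gaussLamMeasure lam))).fst).toLp _⟫ ≤ schauderR0sq hlam α ∧
    ∫ x, Real.exp (-((1 + lam) / 4 * x 0 ^ 2 + (1 - lam) / 4 * x 1 ^ 2)) *
        ‖(((schauderSolve hlam hu : gaussLamFormDomain lam) : WithLp 2 (Lp ℝ 2 (gaussLamMeasure lam) ×
            Lp (EuclideanSpace ℝ (Fin 2)) 2 (gaussLamMeasure lam))).snd : EuclideanSpace ℝ (Fin 2) → EuclideanSpace ℝ (Fin 2)) x -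
          (((schauderSolve hlam hu : gaussLamFormDomain lam) : WithLp 2 (Lp ℝ 2 (gaussLamMeasure lam) ×
            Lp (EuclideanSpace ℝ (Fin 2)) 2 (gaussLamMeasure lam))).fst : EuclideanSpace ℝ (Fin 2) → ℝ) x •
            (toLp 2 ![(1 + lam) / 2 * x 0, (1 - lam) / 2 * x 1] : EuclideanSpace ℝ (Fin 2))‖ ^ 2
        ∂gaussLamMeasure lam ≤ schauderKappa hlam α * schauderR0sq hlam α := by
  obtain ⟨hZ, hR0, hI, hκ1, hRw⟩ := schauder_consts_pos hlam α
  obtain ⟨hnn, hmass, hS, hRwu, hv, hdiv⟩ := mem_schauderSet_data hlam hu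
  have hq : 0 < 1 - lam := by linarith [hlam.2]
  have hκhalf : (1 : ℝ) / 2 ≤ schauderKappa hlam α := by linarith
  have hvm := measurable_velocity u
  have hκge := schauderKappa_ge hlam α
  have hdef : schauderSolve hlam hu = driftSolve lam hvm hv hκge u := rfl
  rw [hdef]
  have hnn' := driftSolve_nonneg lam hvm hv hκge hnn
  have hmass' : ⟪gaussLamOne hlam, ((driftSolve lam hvm hv hκge u : gaussLamFormDomain lam) : WithLp 2 (Lp ℝ 2 (gaussLamMeasure lam) ×
      Lp (EuclideanSpace ℝ (Fin 2)) 2 (gaussLamMeasure lam))).fst⟫ = α := by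
    rw [inner_gaussLamOne_driftSolve lam hvm hv hlam hκge u, hmass]
  have hM : ∫ x : EuclideanSpace ℝ (Fin 2), |Real.exp (-((1 + lam) / 4 * x 0 ^ 2 + (1 - lam) / 4 * x 1 ^ 2)) *
      (((driftSolve lam hvm hv hκge u : gaussLamFormDomain lam) : WithLp 2 (Lp ℝ 2 (gaussLamMeasure lam) ×
        Lp (EuclideanSpace ℝ (Fin 2)) 2 (gaussLamMeasure lam))).fst : EuclideanSpace ℝ (Fin 2) → ℝ) x| = α := by
    rw [integral_abs_weight_mul_eq_inner_one hlam hnn', hmass']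
  have hnash := flatNash_of_mem_gaussLamFormDomain hlam (driftSolve lam hvm hv hκge u).2
  rw [hM] at hnash
  have henergy := flatEnergy_driftSolve hlam hvm hv hκge hdiv u
  have hXt : ⟪u, (memLp_weight_mul_fst hlam u).toLp _⟫ ≤ Real.sqrt (schauderR0sq hlam α) ^ 2 := by
    rw [← norm_sqrtWeightMulL_sq hlam]
    exact pow_le_pow_left₀ (norm_nonneg _) hS 2
  have hC0 : (0 : ℝ) ≤ 4 * (lintegralPowLePowLIntegralFDerivConst (volume : Measure (EuclideanSpace ℝ (Fin 2))) 2 : ℝ) := by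
    positivity
  have hR : 4 * (lintegralPowLePowLIntegralFDerivConst (volume : Measure (EuclideanSpace ℝ (Fin 2))) 2 : ℝ) * α ^ 2 / 2 ≤
      Real.sqrt (schauderR0sq hlam α) ^ 2 := by
    rw [Real.sq_sqrt hR0.le]
    unfold schauderR0sq
    have h1 : 0 ≤ α ^ 2 / schauderZ hlam := by positivity
    have h2 : 0 ≤ 4 * α ^ 2 / ((1 - lam) * schauderZ hlam) := by positivity
    linarith
  have hX := flatBound_preserved hκhalf (inner_fst_weightMul_fst_nonneg hlam _) hC0 hnash henergy hXt hR
  have hD := flatGradBound hκhalf (inner_fst_weightMul_fst_nonneg hlam _) henergy hXt hX (Real.sqrt_nonneg _)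
  rw [Real.sq_sqrt hR0.le] at hX hD
  exact ⟨hnn', hmass', hX, hD⟩

variable {α} in
/-- **`Φ(K) ⊆ K` at the level of pairs**: `U' = schauderSolve u ∈ schauderPairSet` for `u ∈ K`
(flat bounds above, and the self-improving weighted bound `‖u'‖² ≤ ¼‖u‖² + 2e^{s/2}‖ρu'‖₂² ≤ R_w²`,
`‖G'‖² ≤ κ‖u‖²`). [folklore] -/
theorem schauderSolve_mem_schauderPairSet {u : Lp ℝ 2 (gaussLamMeasure lam)} (hu : u ∈ schauderSet hlam α) :
    ((schauderSolve hlam hu : gaussLamFormDomain lam) : WithLp 2 (Lp ℝ 2 (gaussLamMeasure lam) ×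
      Lp (EuclideanSpace ℝ (Fin 2)) 2 (gaussLamMeasure lam))) ∈ schauderPairSet hlam α := by
  obtain ⟨hZ, hR0, hI, hκ1, hRw⟩ := schauder_consts_pos hlam α
  obtain ⟨hnn, hmass, hS, hRwu, hv, hdiv⟩ := mem_schauderSet_data hlam hu
  obtain ⟨hnn', hmass', hX, hD⟩ := schauderSolve_flat hlam hu
  have hvm := measurable_velocity u
  have hκge := schauderKappa_ge hlam α
  have hdef : schauderSolve hlam hu = driftSolve lam hvm hv hκge u := rfl
  have hwb := weightedBound_driftSolve hlam hvm hv hκge (schauderV0_sq_add_one_le hlam α) u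
  rw [← hdef] at hwb
  have hSdef : 4 * (16 / (1 - lam) ^ 2) * schauderKappa hlam α + 2 * (8 / (1 - lam)) = schauderS hlam α := rfl
  rw [hSdef] at hwb
  obtain ⟨hfst, hsnd⟩ := hwb
  have hu2 : ‖u‖ ^ 2 ≤ schauderRwsq hlam α := by
    calc ‖u‖ ^ 2 ≤ Real.sqrt (schauderRwsq hlam α) ^ 2 := pow_le_pow_left₀ (norm_nonneg _) hRwu 2
      _ = schauderRwsq hlam α := Real.sq_sqrt hRw.le
  have hRwdef : schauderRwsq hlam α = 3 * Real.exp (schauderS hlam α / 2) * schauderR0sq hlam α + α ^ 2 / schauderZ hlam :=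
    rfl
  have hfst' : ‖((schauderSolve hlam hu : gaussLamFormDomain lam) : WithLp 2 (Lp ℝ 2 (gaussLamMeasure lam) ×
      Lp (EuclideanSpace ℝ (Fin 2)) 2 (gaussLamMeasure lam))).fst‖ ^ 2 ≤ schauderRwsq hlam α := by
    have h1 := mul_le_mul_of_nonneg_left hX (by positivity : (0 : ℝ) ≤ 2 * Real.exp (schauderS hlam α / 2))
    have h2 : 0 ≤ α ^ 2 / schauderZ hlam := by positivity
    have h3 : 0 ≤ Real.exp (schauderS hlam α / 2) * schauderR0sq hlam α := by positivity
    linarith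
  have hsnd' : ‖((schauderSolve hlam hu : gaussLamFormDomain lam) : WithLp 2 (Lp ℝ 2 (gaussLamMeasure lam) ×
      Lp (EuclideanSpace ℝ (Fin 2)) 2 (gaussLamMeasure lam))).snd‖ ^ 2 ≤ schauderKappa hlam α * schauderRwsq hlam α :=
    hsnd.trans (mul_le_mul_of_nonneg_left hu2 (by linarith))
  have hU' : ‖schauderSolve hlam hu‖ ^ 2 ≤ (1 + schauderKappa hlam α) * schauderRwsq hlam α := by
    rw [norm_sq_formDomain]; linarith
  refine ⟨(schauderSolve hlam hu).2, hnn', hmass', ?_, ?_, ?_, ?_⟩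
  · rw [Real.le_sqrt (norm_nonneg _) hR0.le, norm_sqrtWeightMulL_sq hlam]
    exact hX
  · rw [← Real.sqrt_mul (by linarith : (0 : ℝ) ≤ schauderKappa hlam α),
      Real.le_sqrt (norm_nonneg _) (by positivity), norm_flatGradL_sq hlam]
    exact hD
  · rw [Real.le_sqrt (norm_nonneg _) hRw.le]
    exact hfst'
  · have hn : ‖((schauderSolve hlam hu : gaussLamFormDomain lam) : WithLp 2 (Lp ℝ 2 (gaussLamMeasure lam) ×
        Lp (EuclideanSpace ℝ (Fin 2)) 2 (gaussLamMeasure lam)))‖ = ‖schauderSolve hlam hu‖ := rfl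
    rw [hn, ← Real.sqrt_mul (by linarith : (0 : ℝ) ≤ 1 + schauderKappa hlam α),
      Real.le_sqrt (norm_nonneg _) (by positivity)]
    exact hU'

variable {α} in
/-- **`Φ(K) ⊆ K`**. [folklore] -/
theorem schauderMap_mem {u : Lp ℝ 2 (gaussLamMeasure lam)} (hu : u ∈ schauderSet hlam α) :
    schauderMap hlam α u ∈ schauderSet hlam α := by
  rw [schauderMap_of_mem hlam hu]
  exact ⟨_, schauderSolve_mem_schauderPairSet hlam hu, rfl⟩

/-- `Φ` maps `K` to itself. [folklore] -/
theorem mapsTo_schauderMap : MapsTo (schauderMap hlam α) (schauderSet hlam α) (schauderSet hlam α) :=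
  fun _ hu => schauderMap_mem hlam hu

end TheMap

/-! ### Continuity of `Φ` on `K` -/

section Continuity

include hlam

variable {α} in
/-- The velocities of `u₁, u₂ ∈ K` differ by the velocity of `u₁ − u₂`. [folklore] -/
theorem velocity_sub {u₁ u₂ : Lp ℝ 2 (gaussLamMeasure lam)} (hu₁ : u₁ ∈ schauderSet hlam α)
    (hu₂ : u₂ ∈ schauderSet hlam α) (x : EuclideanSpace ℝ (Fin 2)) :
    biotSavart2D (fun y : EuclideanSpace ℝ (Fin 2) =>
        Real.exp (-((1 + lam) / 4 * y 0 ^ 2 + (1 - lam) / 4 * y 1 ^ 2)) * (u₁ : EuclideanSpace ℝ (Fin 2) → ℝ) y) x -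
      biotSavart2D (fun y : EuclideanSpace ℝ (Fin 2) =>
        Real.exp (-((1 + lam) / 4 * y 0 ^ 2 + (1 - lam) / 4 * y 1 ^ 2)) * (u₂ : EuclideanSpace ℝ (Fin 2) → ℝ) y) x =
      biotSavart2D (fun y : EuclideanSpace ℝ (Fin 2) =>
        Real.exp (-((1 + lam) / 4 * y 0 ^ 2 + (1 - lam) / 4 * y 1 ^ 2)) * ((u₁ - u₂ : Lp ℝ 2 (gaussLamMeasure lam)) :
          EuclideanSpace ℝ (Fin 2) → ℝ) y) x := by
  obtain ⟨U₁, hU₁, rfl⟩ := hu₁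
  obtain ⟨U₂, hU₂, rfl⟩ := hu₂
  unfold biotSavart2D
  rw [← integral_sub (integrable_weight_mul_smul_biotSavartKernel2D hlam hU₁.1 x)
    (integrable_weight_mul_smul_biotSavartKernel2D hlam hU₂.1 x)]
  refine integral_congr_ae ?_
  have hae : ((U₁.fst - U₂.fst : Lp ℝ 2 (gaussLamMeasure lam)) : EuclideanSpace ℝ (Fin 2) → ℝ) =ᵐ[volume]
      (U₁.fst : EuclideanSpace ℝ (Fin 2) → ℝ) - (U₂.fst : EuclideanSpace ℝ (Fin 2) → ℝ) :=
    (ae_gaussLamMeasure_iff (lam := lam)).1 (Lp.coeFn_sub _ _)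
  filter_upwards [hae] with y hy
  rw [hy, Pi.sub_apply, mul_sub, sub_smul]

variable {α} in
/-- **The velocity difference is small**: for `u₁, u₂ ∈ K` with `d = ‖u₁ − u₂‖ > 0`,
`‖v₁(x) − v₂(x)‖ ≤ (2π)⁻¹ ((4R₁ + I₁) √d / 2 + √Z_ρ d)` (flat velocity bound for `U₁ − U₂ ∈ H`
with `t = d^{-1/2}`, `‖S(u₁−u₂)‖ ≤ d`, `‖T(U₁−U₂)‖ ≤ 2R₁`, `‖ρ(u₁−u₂)‖₁ ≤ √Z_ρ d`). [folklore] -/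
theorem norm_velocity_sub_le {u₁ u₂ : Lp ℝ 2 (gaussLamMeasure lam)} (hu₁ : u₁ ∈ schauderSet hlam α)
    (hu₂ : u₂ ∈ schauderSet hlam α) (hd : 0 < ‖u₁ - u₂‖) (x : EuclideanSpace ℝ (Fin 2)) :
    ‖biotSavart2D (fun y : EuclideanSpace ℝ (Fin 2) =>
        Real.exp (-((1 + lam) / 4 * y 0 ^ 2 + (1 - lam) / 4 * y 1 ^ 2)) * (u₁ : EuclideanSpace ℝ (Fin 2) → ℝ) y) x -
      biotSavart2D (fun y : EuclideanSpace ℝ (Fin 2) =>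
        Real.exp (-((1 + lam) / 4 * y 0 ^ 2 + (1 - lam) / 4 * y 1 ^ 2)) * (u₂ : EuclideanSpace ℝ (Fin 2) → ℝ) y) x‖ ≤
      (2 * Real.pi)⁻¹ * ((4 * (Real.sqrt (schauderKappa hlam α) * Real.sqrt (schauderR0sq hlam α)) + schauderI1) *
          Real.sqrt ‖u₁ - u₂‖ / 2 +
        Real.sqrt (∫ y : EuclideanSpace ℝ (Fin 2), Real.exp (-((1 + lam) / 4 * y 0 ^ 2 + (1 - lam) / 4 * y 1 ^ 2))) *
          ‖u₁ - u₂‖) := by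
  rw [velocity_sub hlam hu₁ hu₂]
  obtain ⟨U₁, hU₁, rfl⟩ := hu₁
  obtain ⟨U₂, hU₂, rfl⟩ := hu₂
  obtain ⟨hZ, hR0, hI, hκ1, hRw⟩ := schauder_consts_pos hlam α
  have hmem : U₁ - U₂ ∈ gaussLamFormDomain lam := (gaussLamFormDomain lam).sub_mem hU₁.1 hU₂.1
  set s := Real.sqrt ‖U₁.fst - U₂.fst‖ with hs
  have hs0 : 0 < s := Real.sqrt_pos.2 hd
  have hss : s * s = ‖U₁.fst - U₂.fst‖ := Real.mul_self_sqrt (norm_nonneg _)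
  have h := norm_biotSavart2D_weight_mul_le_flat hlam hmem x (t := s⁻¹) (by positivity)
  have hX : Real.sqrt ⟪(U₁ - U₂).fst, (memLp_weight_mul_fst hlam (U₁ - U₂).fst).toLp _⟫ =
      ‖sqrtWeightMulL hlam (U₁ - U₂).fst‖ := by
    rw [← norm_sqrtWeightMulL_sq hlam, Real.sqrt_sq (norm_nonneg _)]
  have hD : Real.sqrt (∫ x, Real.exp (-((1 + lam) / 4 * x 0 ^ 2 + (1 - lam) / 4 * x 1 ^ 2)) *
      ‖((U₁ - U₂).snd : EuclideanSpace ℝ (Fin 2) → EuclideanSpace ℝ (Fin 2)) x -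
        ((U₁ - U₂).fst : EuclideanSpace ℝ (Fin 2) → ℝ) x •
          (toLp 2 ![(1 + lam) / 2 * x 0, (1 - lam) / 2 * x 1] : EuclideanSpace ℝ (Fin 2))‖ ^ 2 ∂gaussLamMeasure lam) =
      ‖flatGradL hlam (U₁ - U₂)‖ := by
    rw [← norm_flatGradL_sq hlam, Real.sqrt_sq (norm_nonneg _)]
  have hM := (integrable_weight_mul_Lp hlam (U₁ - U₂).fst).2
  rw [hX, hD] at h
  rw [WithLp.sub_fst] at h hM
  -- the pieces
  have hSle : ‖sqrtWeightMulL hlam (U₁.fst - U₂.fst)‖ ≤ ‖U₁.fst - U₂.fst‖ := by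
    have h1 : ‖sqrtWeightMulL hlam (U₁.fst - U₂.fst)‖ ^ 2 ≤ ‖U₁.fst - U₂.fst‖ ^ 2 := by
      rw [norm_sqrtWeightMulL_sq hlam]; exact inner_fst_weightMul_fst_le hlam _
    exact (pow_le_pow_iff_left₀ (norm_nonneg _) (norm_nonneg _) two_ne_zero).1 h1
  have hTle : ‖flatGradL hlam (U₁ - U₂)‖ ≤ 2 * (Real.sqrt (schauderKappa hlam α) * Real.sqrt (schauderR0sq hlam α)) := by
    rw [map_sub]
    refine (norm_sub_le _ _).trans ?_
    linarith [hU₁.2.2.2.2.1, hU₂.2.2.2.2.1]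
  have hπ : (0 : ℝ) ≤ (2 * Real.pi)⁻¹ := by positivity
  refine h.trans (mul_le_mul_of_nonneg_left ?_ hπ)
  have hI1 : ∫ z, indicator (ball (0 : EuclideanSpace ℝ (Fin 2)) 1) (fun z => ‖z‖⁻¹) z = schauderI1 := rfl
  rw [hI1, inv_inv]
  have hprod : ‖sqrtWeightMulL hlam (U₁.fst - U₂.fst)‖ * ‖flatGradL hlam (U₁ - U₂)‖ ≤
      ‖U₁.fst - U₂.fst‖ * (2 * (Real.sqrt (schauderKappa hlam α) * Real.sqrt (schauderR0sq hlam α))) :=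
    mul_le_mul hSle hTle (norm_nonneg _) (norm_nonneg _)
  have hkey : s⁻¹ * (2 * ‖sqrtWeightMulL hlam (U₁.fst - U₂.fst)‖ * ‖flatGradL hlam (U₁ - U₂)‖) ≤
      4 * (Real.sqrt (schauderKappa hlam α) * Real.sqrt (schauderR0sq hlam α)) * s := by
    rw [inv_mul_le_iff₀ hs0]
    calc 2 * ‖sqrtWeightMulL hlam (U₁.fst - U₂.fst)‖ * ‖flatGradL hlam (U₁ - U₂)‖
        ≤ 2 * (‖U₁.fst - U₂.fst‖ * (2 * (Real.sqrt (schauderKappa hlam α) * Real.sqrt (schauderR0sq hlam α)))) := by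
          nlinarith [hprod]
      _ = s * (4 * (Real.sqrt (schauderKappa hlam α) * Real.sqrt (schauderR0sq hlam α)) * s) := by
          rw [← hss]; ring
  have hfin : s⁻¹ * (2 * ‖sqrtWeightMulL hlam (U₁.fst - U₂.fst)‖ * ‖flatGradL hlam (U₁ - U₂)‖) + s * schauderI1 ≤
      (4 * (Real.sqrt (schauderKappa hlam α) * Real.sqrt (schauderR0sq hlam α)) + schauderI1) * s := by
    nlinarith [hkey]
  have hM' := hM
  linarith [hfin, hM', div_le_div_of_nonneg_right hfin two_pos.le]

variable {α} in
/-- **Lipschitz-type estimate for `Φ` on `K`**: if `‖v₁ − v₂‖ ≤ W` pointwise then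
`‖Φu₁ − Φu₂‖ ≤ 2κ‖u₁ − u₂‖ + 2W R_w`. [folklore] -/
theorem norm_schauderMap_sub_le {u₁ u₂ : Lp ℝ 2 (gaussLamMeasure lam)} (hu₁ : u₁ ∈ schauderSet hlam α)
    (hu₂ : u₂ ∈ schauderSet hlam α) {W : ℝ}
    (hW : ∀ x, ‖biotSavart2D (fun y : EuclideanSpace ℝ (Fin 2) =>
        Real.exp (-((1 + lam) / 4 * y 0 ^ 2 + (1 - lam) / 4 * y 1 ^ 2)) * (u₁ : EuclideanSpace ℝ (Fin 2) → ℝ) y) x -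
      biotSavart2D (fun y : EuclideanSpace ℝ (Fin 2) =>
        Real.exp (-((1 + lam) / 4 * y 0 ^ 2 + (1 - lam) / 4 * y 1 ^ 2)) * (u₂ : EuclideanSpace ℝ (Fin 2) → ℝ) y) x‖ ≤ W) :
    ‖schauderMap hlam α u₁ - schauderMap hlam α u₂‖ ≤
      2 * schauderKappa hlam α * ‖u₁ - u₂‖ + 2 * W * Real.sqrt (schauderRwsq hlam α) := by
  rw [schauderMap_of_mem hlam hu₁, schauderMap_of_mem hlam hu₂]
  obtain ⟨-, -, -, -, hv₁, -⟩ := mem_schauderSet_data hlam hu₁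
  obtain ⟨-, -, -, -, hv₂, -⟩ := mem_schauderSet_data hlam hu₂
  have hκge := schauderKappa_ge hlam α
  have h := norm_driftSolve_sub_le lam (measurable_velocity u₁) hv₁ hκge (measurable_velocity u₂) hv₂ hW u₁ u₂
  have hd₁ : schauderSolve hlam hu₁ = driftSolve lam (measurable_velocity u₁) hv₁ hκge u₁ := rfl
  have hd₂ : schauderSolve hlam hu₂ = driftSolve lam (measurable_velocity u₂) hv₂ hκge u₂ := rfl
  rw [← hd₁, ← hd₂] at h
  have hfst : ‖((schauderSolve hlam hu₁ : gaussLamFormDomain lam) : WithLp 2 (Lp ℝ 2 (gaussLamMeasure lam) ×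
        Lp (EuclideanSpace ℝ (Fin 2)) 2 (gaussLamMeasure lam))).fst -
      ((schauderSolve hlam hu₂ : gaussLamFormDomain lam) : WithLp 2 (Lp ℝ 2 (gaussLamMeasure lam) ×
        Lp (EuclideanSpace ℝ (Fin 2)) 2 (gaussLamMeasure lam))).fst‖ ≤ ‖schauderSolve hlam hu₁ - schauderSolve hlam hu₂‖ := by
    have := (norm_fst_le_and_norm_snd_le_formDomain (schauderSolve hlam hu₁ - schauderSolve hlam hu₂)).1
    rwa [Submodule.coe_sub, WithLp.sub_fst] at this
  have hW0 : 0 ≤ W := (norm_nonneg _).trans (hW 0)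
  have hb := (schauderSolve_mem_schauderPairSet hlam hu₂).2.2.2.2.2.1
  have h3 := mul_le_mul_of_nonneg_left hb (by positivity : (0 : ℝ) ≤ 2 * W)
  linarith

/-- **`Φ` is continuous on `K`** (with a Hölder-½ modulus). [folklore] -/
theorem continuousOn_schauderMap : ContinuousOn (schauderMap hlam α) (schauderSet hlam α) := by
  obtain ⟨hZ, hR0, hI, hκ1, hRw⟩ := schauder_consts_pos hlam α
  set R₁ : ℝ := Real.sqrt (schauderKappa hlam α) * Real.sqrt (schauderR0sq hlam α) with hR₁
  set Zρ : ℝ := ∫ y : EuclideanSpace ℝ (Fin 2), Real.exp (-((1 + lam) / 4 * y 0 ^ 2 + (1 - lam) / 4 * y 1 ^ 2)) with hZρ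
  set g : ℝ → ℝ := fun d => 2 * schauderKappa hlam α * d +
    2 * ((2 * Real.pi)⁻¹ * ((4 * R₁ + schauderI1) * Real.sqrt d / 2 + Real.sqrt Zρ * d)) *
      Real.sqrt (schauderRwsq hlam α) with hg
  have hgc : Continuous g := by
    rw [hg]
    fun_prop
  have hg0 : g 0 = 0 := by simp [hg]
  rw [Metric.continuousOn_iff]
  intro u₂ hu₂ ε hε
  obtain ⟨δ, hδ, hgδ⟩ := Metric.continuous_iff.1 hgc 0 ε hε
  refine ⟨δ, hδ, fun u₁ hu₁ hdist => ?_⟩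
  rcases eq_or_ne u₁ u₂ with rfl | hne
  · simpa using hε
  have hd0 : 0 < ‖u₁ - u₂‖ := norm_pos_iff.2 (sub_ne_zero.2 hne)
  have hbound : dist (schauderMap hlam α u₁) (schauderMap hlam α u₂) ≤ g ‖u₁ - u₂‖ := by
    rw [dist_eq_norm, hg]
    exact norm_schauderMap_sub_le hlam hu₁ hu₂ (fun x => norm_velocity_sub_le hlam hu₁ hu₂ hd0 x)
  have h := hgδ ‖u₁ - u₂‖ (by rwa [dist_zero_right, Real.norm_of_nonneg (norm_nonneg _), ← dist_eq_norm])
  rw [hg0, Real.dist_eq, sub_zero] at h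
  exact hbound.trans_lt (lt_of_abs_lt h)

end Continuity

/-! ### Compactness of `Φ(K)` and the fixed point -/

section Existence

include hlam

/-- **`Φ(K)` is relatively compact** in `L²(μ_λ)`: it lies in the `H`-ball of radius `R_H`, whose
first components form a relatively compact set (Gaussian Rellich theorem). [folklore] -/
theorem isCompact_closure_image_schauderMap :
    IsCompact (closure (schauderMap hlam α '' schauderSet hlam α)) := by
  refine (isCompact_closure_fst_of_norm_le hlam
    (Real.sqrt (1 + schauderKappa hlam α) * Real.sqrt (schauderRwsq hlam α))).of_isClosed_subset
    isClosed_closure (closure_mono ?_)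
  rintro _ ⟨u, hu, rfl⟩
  obtain ⟨U, hU, hUu⟩ := schauderMap_mem hlam hu
  exact ⟨U, hU.1, hUu, hU.2.2.2.2.2.2⟩

variable {α} in
/-- **The fixed point** (Schauder): for `α ≥ 0` there is `u ∈ K` with `Φ u = u`. [folklore] -/
theorem exists_fixedPoint_schauderMap (hα : 0 ≤ α) : ∃ u ∈ schauderSet hlam α, schauderMap hlam α u = u :=
  Literature.Analysis.Convex.exists_fixedPoint_of_isCompact_closure (convex_schauderSet hlam α)
    (isClosed_schauderSet hlam α) (schauderSet_nonempty hlam hα) (continuousOn_schauderMap hlam α)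
    (mapsTo_schauderMap hlam α) (isCompact_closure_image_schauderMap hlam α)

variable {α} in
/-- **Existence of a weak solution for `α ≥ 0`** (Gallay–Maekawa 2016, Thm. 4.1, existence part, in
the ground-state variables): there is `U = (u, G) ∈ H = H¹(μ_λ)` with `u ≥ 0`, `∫ u dμ_λ = α`
(i.e. `∫ ρu dx = α`), a bounded velocity `v = K_{2D} ∗ (ρu)`, `‖v‖ ≤ V₀`, and the weak equation
`⟪G, G_Φ⟫ = ∫ u ⟪v, G_Φ⟫ dμ_λ` for all `Φ = (φ, G_Φ) ∈ H` — the weak form of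
`L_λ w = (v·∇) w`, `w = ρ_λ u`. [cite: GallayMaekawa2016, Thm. 4.1] -/
theorem exists_weakSolution_nonneg (hα : 0 ≤ α) :
    ∃ U ∈ gaussLamFormDomain lam, 0 ≤ᵐ[gaussLamMeasure lam] (U.fst : EuclideanSpace ℝ (Fin 2) → ℝ) ∧
      ⟪gaussLamOne hlam, U.fst⟫ = α ∧
      (∀ x, ‖biotSavart2D (fun y : EuclideanSpace ℝ (Fin 2) =>
        Real.exp (-((1 + lam) / 4 * y 0 ^ 2 + (1 - lam) / 4 * y 1 ^ 2)) * (U.fst : EuclideanSpace ℝ (Fin 2) → ℝ) y) x‖ ≤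
          schauderV0 hlam α) ∧
      ∀ Φ ∈ gaussLamFormDomain lam, ⟪U.snd, Φ.snd⟫ =
        ∫ x, (U.fst : EuclideanSpace ℝ (Fin 2) → ℝ) x *
          ⟪biotSavart2D (fun y : EuclideanSpace ℝ (Fin 2) =>
              Real.exp (-((1 + lam) / 4 * y 0 ^ 2 + (1 - lam) / 4 * y 1 ^ 2)) * (U.fst : EuclideanSpace ℝ (Fin 2) → ℝ) y) x,
            (Φ.snd : EuclideanSpace ℝ (Fin 2) → EuclideanSpace ℝ (Fin 2)) x⟫ ∂gaussLamMeasure lam := by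
  obtain ⟨u, hu, hfix⟩ := exists_fixedPoint_schauderMap hlam hα
  rw [schauderMap_of_mem hlam hu] at hfix
  obtain ⟨hnn, hmass, hS, hRwu, hv, hdiv⟩ := mem_schauderSet_data hlam hu
  have hκge := schauderKappa_ge hlam α
  have hdef : schauderSolve hlam hu = driftSolve lam (measurable_velocity u) hv hκge u := rfl
  refine ⟨(schauderSolve hlam hu : gaussLamFormDomain lam), (schauderSolve hlam hu).2, ?_, ?_, ?_, ?_⟩
  · rw [hfix]; exact hnn
  · rw [hfix]; exact hmass
  · rw [hfix]; exact hv
  · intro Φ hΦ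
    have hspec := driftSolve_spec lam (measurable_velocity u) hv hκge u ⟨Φ, hΦ⟩
    rw [driftForm_apply, ← hdef] at hspec
    rw [hfix] at hspec ⊢
    have h2 : ⟪((schauderSolve hlam hu : gaussLamFormDomain lam) : WithLp 2 (Lp ℝ 2 (gaussLamMeasure lam) ×
        Lp (EuclideanSpace ℝ (Fin 2)) 2 (gaussLamMeasure lam))).snd, Φ.snd⟫ =
        ⟪fieldMulL (measurable_velocity u) hv u, Φ.snd⟫ := by
      linarith [hspec]
    rw [h2, inner_fieldMulL]

end Existence

end Literature.Analysis.FluidPDE
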